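import Mathlib
import HarnessLib
import Summits.ResolutionOfSingularities.ResolutionOfSingularities.Theorems.WildQuotientsWildQuotientResolutionStubQuotientModel
import Summits.ResolutionOfSingularities.ResolutionOfSingularities.Theorems.WildQuotientsWildQuotientResolutionStubBirational
import Summits.ResolutionOfSingularities.ResolutionOfSingularities.Theorems.WildQuotientsWildQuotientResolutionPhaseZeroPClosed
import Literature.AlgebraicGeometry.Resolution.FiniteBirationalNormal

/-!
# `X₁` IS the quotient `X′/G` when it is normal (crux stmt-ResolutionOfSingularities-15640, line `Sketch`, skeleton v5)

Support for the sharpened p-closed stub `stub_pClosedWQNormal` of the skeleton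
`Cruxes/WildQuotientResolution/Lines/Sketch.lean` (v5, lead c3) of the crux
`WildQuotients.WildQuotientResolution`. The crux presents the quotient variety only through the
finite surjective `G`-invariant `q : X′ → X₁` with fibres the `G`-orbits, étale over a dense open;
skeleton v5 adds to the promoted p-closed sub-problem the WLOG hypotheses "`ρ` faithful, `X₁`
normal, `dim X₁ > 0`". This file certifies the docstring claim that under these hypotheses `X₁`
IS the quotient: the morphism `r : X′/G → X₁` descended from `q` through the tree's glued quotient
(`Literature.AlgebraicGeometry.RelativeSpec.ActionOver.glued`, SGA 1 V §1) is an ISOMORPHISM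
(`isIso_gluedDesc_of_normal`). Proof: `r` is proper (`isProper_gluedDesc`), quasi-finite (its
fibres are images of the finite fibres of `q` under the surjective `X′ → X′/G`), hence finite by
Zariski's Main Theorem (Mathlib `IsFinite.of_isProper_of_locallyQuasiFinite`); it is birational
by the W-clause of the quotient model (`QuotientModel.exists_dense_isFinite_etale_bijective` with
the identity model) and lemma (L) (`Birational.stub_birational_of_bijective`, positive dimension);
and a finite birational morphism of integral schemes onto a NORMAL scheme is an isomorphism
(`isIso_of_isFinite_of_isBirational`, de Jong 1996 4.20–4.21). So a solver of PClosedWQNormal may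
replace `X₁` by `X′/G` with its chart structure (`Spec Γ(O)^G` for `G`-stable affines `O`).
-/

-- single-problem summit: the doubled namespace component `ResolutionOfSingularities` is forced
set_option linter.dupNamespace false

noncomputable section

open CategoryTheory Limits AlgebraicGeometry TopologicalSpace
open Literature.AlgebraicGeometry.Resolution Literature.AlgebraicGeometry.RelativeSpec

namespace Summit.ResolutionOfSingularities.ResolutionOfSingularities.Theorems.WildQuotientResolution.QuotientIso

/-- **`G`-stable affine cover in the `StableAffineOpens` format**: for an action `ρB` of `G` on
`X′` over `X₁` through the affine `q`, every point lies in a `G`-stable open which is affine over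
`X₁` (`PClosedCase.exists_isAffineOpen_stable` repackaged; an affine scheme maps affinely to the
separated `X₁`). [folklore; cf. MumfordAV1970 §7] -/
theorem exists_stableAffineOpens {X' X₁ : Scheme.{0}} (q : X' ⟶ X₁) [IsAffineHom q]
    [X₁.IsSeparated] {G : Type} [Group G] (ρB : ActionOver q G) (x : X') :
    ∃ O : ρB.StableAffineOpens, x ∈ O.1 := by
  obtain ⟨U, hU, hxU, hUst⟩ := PClosedCase.exists_isAffineOpen_stable q ρB.aut ρB.aut_comp x
  haveI : IsAffine U := hU
  exact ⟨⟨U, hUst, isAffineHom_of_isAffine_of_isSeparated _⟩, hxU⟩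

/-- **`X₁` is the quotient `X′/G` when it is normal.** Let `q : X′ → X₁` be finite and surjective
between integral schemes, `X₁` separated of finite type over a field `k`, NORMAL and of positive
dimension, and let the finite group `G` act FAITHFULLY on `X′` over `X₁` (`ρB : ActionOver q G`)
with fibres of `q` the `G`-orbits and `q` étale over a dense open. Then the morphism
`r : X′/G → X₁` descended from `q` (`ActionOver.gluedDesc`) is an isomorphism: proper and
quasi-finite hence finite (Zariski's Main Theorem), birational by the W-clause and lemma (L), and
finite birational onto a normal integral scheme. [cite: SGA1, Exp. V, §1, Prop. 1.1 and §2 Prop. 2.6]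
[cite: DeJong1996, 4.20–4.21, pp. 73–74] -/
theorem isIso_gluedDesc_of_normal (k : Type) [Field k] {X' X₁ : Scheme.{0}}
    (f : X₁ ⟶ Spec (.of k)) (q : X' ⟶ X₁) {G : Type} [Group G] [Finite G] (ρB : ActionOver q G)
    (hfaith : Function.Injective ρB.aut) [X₁.IsSeparated] [LocallyOfFiniteType f] [IsIntegral X₁]
    [IsIntegral X'] [IsFinite q] (hnorm : ∀ x : X₁, IsIntegrallyClosed (X₁.presheaf.stalk x))
    (hdim : ¬ topologicalKrullDim X₁ ≤ 0) (hsurj : Function.Surjective q.base)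
    (hU : ∃ U : X₁.Opens, Dense (U : Set X₁) ∧ Etale (q ∣_ U))
    (horb : ∀ x y : X', q.base x = q.base y → ∃ g : G, (ρB.aut g).hom.base x = y) :
    IsIso (ρB.gluedDesc q ρB.aut_comp) := by
  classical
  haveI : IsLocallyNoetherian X₁ := LocallyOfFiniteType.isLocallyNoetherian f
  -- Work with the action viewed over `𝟙 X′ ≫ q` (definitionally `q`): this is the syntactic shape
  -- in which the W-clause of the quotient model is stated (identity Phase-0 model `π = 𝟙`).
  let ρB' : ActionOver (𝟙 X' ≫ q) G := ρB
  have hcov : ∀ x : X', ∃ O : ρB'.StableAffineOpens, x ∈ O.1 := exists_stableAffineOpens q ρB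
  haveI hY₁ : IsIntegral ρB'.glued := ρB'.isIntegral_glued hcov
  haveI hr : IsProper (ρB'.gluedDesc (𝟙 X' ≫ q) ρB'.aut_comp) :=
    ρB'.isProper_gluedDesc hcov (𝟙 X' ≫ q) ρB'.aut_comp (𝟙 X₁) (Category.comp_id _)
  have hqr : ρB'.gluedMk hcov ≫ ρB'.gluedDesc (𝟙 X' ≫ q) ρB'.aut_comp = 𝟙 X' ≫ q :=
    ρB'.gluedMk_gluedDesc hcov _ _
  -- the W-clause of the quotient model for the identity model
  obtain ⟨W, hWd, hWfin, hWet, hWbij⟩ :=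
    QuotientModel.exists_dense_isFinite_etale_bijective (𝟙 X') q ρB' hcov hfaith ρB.aut
      (fun g => by simp [ρB']) horb hsurj hU ⟨⊤, by simp, by simp, inferInstance⟩
  haveI := hWfin; haveI := hWet
  -- birational by lemma (L)
  have hbir : IsBirational (ρB'.gluedDesc (𝟙 X' ≫ q) ρB'.aut_comp) :=
    Birational.stub_birational_of_bijective k f _ hdim W hWd hWbij
  -- finite: proper and quasi-finite (Zariski's Main Theorem)
  haveI : LocallyOfFiniteType (ρB'.gluedDesc (𝟙 X' ≫ q) ρB'.aut_comp) :=
    ρB'.locallyOfFiniteType_gluedDesc_base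
  haveI : LocallyQuasiFinite (ρB'.gluedDesc (𝟙 X' ≫ q) ρB'.aut_comp) := by
    refine LocallyQuasiFinite.of_finite_preimage_singleton _ fun y => ?_
    refine ((q.finite_preimage_singleton y).image (ρB'.gluedMk hcov).base).subset fun z hz => ?_
    obtain ⟨x, rfl⟩ := ρB'.gluedMk_surjective hcov z
    refine ⟨x, ?_, rfl⟩
    have hx : (𝟙 X' ≫ q).base x = (ρB'.gluedDesc (𝟙 X' ≫ q) ρB'.aut_comp).base
        ((ρB'.gluedMk hcov).base x) := by
      rw [← Scheme.Hom.comp_apply, hqr]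
    show q.base x ∈ ({y} : Set X₁)
    rw [Set.mem_singleton_iff]
    exact hx.trans hz
  haveI : IsFinite (ρB'.gluedDesc (𝟙 X' ≫ q) ρB'.aut_comp) :=
    IsFinite.of_isProper_of_locallyQuasiFinite _
  exact isIso_of_isFinite_of_isBirational (ρB'.gluedDesc (𝟙 X' ≫ q) ρB'.aut_comp) hnorm hbir

/-- **The quotient presentation of the crux data, for normal `X₁`** (the form a solver of
`stub_pClosedWQNormal` uses): with `ρ : G →* Aut X′` faithful and `q`-invariant, `X₁` normal of
positive dimension, fibres = orbits and `q` generically étale, there is an isomorphism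
`e : X′/G ≅ X₁` with `π ≫ e.hom = q`, where `X′/G = (⟨ρ, hρ⟩ : ActionOver q G).glued` is the tree's
glued quotient and `π` its quotient map `gluedMk`. [folklore; SGA1 Exp. V §1] -/
theorem exists_iso_glued_of_normal (k : Type) [Field k] {X' X₁ : Scheme.{0}}
    (f : X₁ ⟶ Spec (.of k)) (q : X' ⟶ X₁) {G : Type} [Group G] [Finite G] (ρ : G →* Aut X')
    (hfaith : Function.Injective ρ) (hρ : ∀ g : G, (ρ g).hom ≫ q = q) [X₁.IsSeparated]
    [LocallyOfFiniteType f] [IsIntegral X₁] [IsIntegral X'] [IsFinite q]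
    (hnorm : ∀ x : X₁, IsIntegrallyClosed (X₁.presheaf.stalk x))
    (hdim : ¬ topologicalKrullDim X₁ ≤ 0) (hsurj : Function.Surjective q.base)
    (hU : ∃ U : X₁.Opens, Dense (U : Set X₁) ∧ Etale (q ∣_ U))
    (horb : ∀ x y : X', q.base x = q.base y → ∃ g : G, (ρ g).hom.base x = y) :
    ∃ (hcov : ∀ x : X', ∃ O : (⟨ρ, hρ⟩ : ActionOver q G).StableAffineOpens, x ∈ O.1)
      (e : (⟨ρ, hρ⟩ : ActionOver q G).glued ≅ X₁),
      (⟨ρ, hρ⟩ : ActionOver q G).gluedMk hcov ≫ e.hom = q := by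
  set ρB : ActionOver q G := ⟨ρ, hρ⟩
  have hcov : ∀ x : X', ∃ O : ρB.StableAffineOpens, x ∈ O.1 := exists_stableAffineOpens q ρB
  haveI := isIso_gluedDesc_of_normal k f q ρB hfaith hnorm hdim hsurj hU horb
  exact ⟨hcov, asIso (ρB.gluedDesc q ρB.aut_comp), ρB.gluedMk_gluedDesc hcov _ _⟩

end Summit.ResolutionOfSingularities.ResolutionOfSingularities.Theorems.WildQuotientResolution.QuotientIso

end
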